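import Literature.RingTheory.DiscreteValuationRing.UnramifiedExtensionZorn
import Literature.AlgebraicGeometry.Resolution.AdicCompletionRegular
import Mathlib.RingTheory.DiscreteValuationRing.TFAE
import Mathlib.RingTheory.Henselian
import Mathlib.RingTheory.Flat.TorsionFree
import Mathlib.RingTheory.Flat.FaithfullyFlat.Basic
import Mathlib.RingTheory.RingHom.FaithfullyFlat
import Mathlib.FieldTheory.IsSepClosed
import Mathlib.RingTheory.Localization.Basic
import HarnessLib

/-!
# Complete unramified extensions of a discrete valuation ring with algebraically closed
# residue field ("strictly local" covers of a DVR)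

Topic: `Literature/RingTheory/DiscreteValuationRing`. For a discrete valuation ring `R` with
residue field `k` we construct a faithfully flat extension of discrete valuation rings `R → R'`
of ramification index `1` (`𝔪_R R' = 𝔪_{R'}`) with `R'` COMPLETE (hence henselian) and with
ALGEBRAICALLY CLOSED residue field: `R'` is the completion of the DVR `B ⊇ R` with residue field
`k̄` supplied by Matsumura's Thm. 29.1 (`UnramifiedExtensionZorn.lean`, EGA 0_III 10.3.1). For
`R = 𝒪_K` (`K` a local field) this is `𝒪̂_{K^nr} = W(k̄) ⊗_{W(k)} 𝒪_K` (Serre, *Local Fields*,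
II §5 / IV §4 Prop. 16: `e = 1`); over a strictly local base smooth schemes have enough sections,
which is how such covers enter Weil's construction of group schemes from birational group laws
and the existence of Néron models (Artin, *Néron models*, Notation (4) "strictly local, meaning
henselian, with separably closed residue field"; Edixhoven–Romagny §2, Weil 1955, work over an
algebraically closed field).

## Content (namespace `Literature.RingTheory.DiscreteValuationRing`), all PROVED

* `henselianLocalRing_of_isAdicComplete` — a local ring complete for its maximal ideal is
  henselian (Mathlib's `IsAdicComplete.henselianRing`, repackaged as `HenselianLocalRing`).
* `isDomain_adicCompletion`, `isDiscreteValuationRing_adicCompletion`,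
  `henselianLocalRing_adicCompletion`, `isAlgClosed_residueField_adicCompletion` — the
  `𝔪`-adic completion of a DVR is a complete (henselian) DVR with the same residue field.
* `isLocalization_algebraMapSubmonoid_nonZeroDivisors` — for DVRs `R → R'` with
  `𝔪_R R' = 𝔪_{R'}`: `Frac R' = R'[1/π]`, the localisation at the image of `R ∖ {0}`.
* `exists_complete_dvr_faithfullyFlat_unramified_isAlgClosed` — **the cover**: for every DVR `R`
  a DVR `R'`, an `R`-algebra, with `IsAdicComplete 𝔪_{R'} R'`, `HenselianLocalRing R'`,
  `IsAlgClosed (ResidueField R')`, `Module.FaithfullyFlat R R'` (also as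
  `(algebraMap R R').FaithfullyFlat`), `algebraMap` injective and `𝔪_R R' = 𝔪_{R'}`.
* `exists_strictlyLocal_dvr_faithfullyFlat_unramified` — the same in Artin's "strictly local"
  currency (`HenselianLocalRing` + `IsSepClosed (ResidueField R')`), i.e. the hypothesis block of
  `Literature.NumberTheory.EllipticCurves.exists_isNeronModel_strictlyLocal`.

## Sources

* H. Matsumura, *Commutative Ring Theory*, CUP 1986: Thm. 29.1 (p. 223); §8 (completion).
  [Matsumura1987]
* J.-P. Serre, *Local Fields*, GTM 67, Ch. II §5 and Ch. IV §4 Prop. 16. [SerreLocalFields1979]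
* M. Artin, *Néron Models* (Cornell–Silverman Ch. VIII), Notation (4), p. 213.
  [Artin1986NeronModels]
-/

noncomputable section

namespace Literature.RingTheory.DiscreteValuationRing

universe u

open IsLocalRing Literature.AlgebraicGeometry.Resolution

/-! ## Complete local rings are henselian -/

/-- A local ring which is complete for the adic topology of its maximal ideal is a henselian
local ring (Hensel's lemma by Newton iteration: Mathlib's `IsAdicComplete.henselianRing`,
repackaged in the `HenselianLocalRing` class). [cite: Matsumura1987, Thm. 8.3] -/
theorem henselianLocalRing_of_isAdicComplete (S : Type u) [CommRing S] [IsLocalRing S]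
    [IsAdicComplete (maximalIdeal S) S] : HenselianLocalRing S where
  is_henselian f hf a₀ h₁ h₂ :=
    HenselianRing.is_henselian (I := maximalIdeal S) f hf a₀ h₁ (h₂.map _)

/-! ## The completion of a discrete valuation ring -/

section Completion

variable (B : Type u) [CommRing B] [IsDomain B] [IsDiscreteValuationRing B]

/-- The `𝔪`-adic completion of a DVR is a domain (it is a regular local ring:
`isRegularLocalRing_adicCompletion`). [cite: Matsumura1987, §19 p. 158 (proof of Thm. 19.5)] -/
theorem isDomain_adicCompletion : IsDomain (AdicCompletion (maximalIdeal B) B) :=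
  haveI := isRegularLocalRing_adicCompletion B
  isDomain_of_isRegularLocalRing _

/-- **The `𝔪`-adic completion of a DVR is a DVR** (Noetherian local domain, not a field, with
principal maximal ideal `𝔪_B B̂`). [cite: Matsumura1987, Thm. 8.11 and §11] -/
theorem isDiscreteValuationRing_adicCompletion :
    letI := isDomain_adicCompletion B
    IsDiscreteValuationRing (AdicCompletion (maximalIdeal B) B) := by
  haveI := isDomain_adicCompletion B
  haveI : IsNoetherianRing (AdicCompletion (maximalIdeal B) B) :=
    isNoetherianRing_adicCompletion_maximalIdeal B
  obtain ⟨ϖ, hϖ⟩ := IsDiscreteValuationRing.exists_irreducible B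
  have hmax : maximalIdeal (AdicCompletion (maximalIdeal B) B) =
      Ideal.span {algebraMap B (AdicCompletion (maximalIdeal B) B) ϖ} := by
    rw [AdicCompletion.maximalIdeal_eq_map, hϖ.maximalIdeal_eq, Ideal.map_span,
      Set.image_singleton]
  have hne : algebraMap B (AdicCompletion (maximalIdeal B) B) ϖ ≠ 0 := by
    rw [AdicCompletion.algebraMap_apply, Algebra.algebraMap_self, RingHom.id_apply]
    intro h
    exact hϖ.ne_zero (AdicCompletion.of_injective (maximalIdeal B) B (by rw [h, map_zero]))
  have hnotfield : ¬IsField (AdicCompletion (maximalIdeal B) B) := fun hF => by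
    have hbot := IsLocalRing.isField_iff_maximalIdeal_eq.mp hF
    have hmem : algebraMap B (AdicCompletion (maximalIdeal B) B) ϖ ∈
        maximalIdeal (AdicCompletion (maximalIdeal B) B) := by
      rw [hmax]
      exact Ideal.mem_span_singleton_self _
    rw [hbot, Ideal.mem_bot] at hmem
    exact hne hmem
  have hprinc : (maximalIdeal (AdicCompletion (maximalIdeal B) B)).IsPrincipal := ⟨⟨_, hmax⟩⟩
  exact ((IsDiscreteValuationRing.TFAE _ hnotfield).out 0 4).mpr hprinc

/-- The `𝔪`-adic completion of a DVR is a henselian local ring (it is complete).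
[cite: Matsumura1987, Thm. 8.3] -/
theorem henselianLocalRing_adicCompletion :
    HenselianLocalRing (AdicCompletion (maximalIdeal B) B) :=
  henselianLocalRing_of_isAdicComplete _

/-- The residue field of the `𝔪`-adic completion of a DVR is that of the DVR
(`B̂/𝔪B̂ = B/𝔪`, Mathlib's `AdicCompletion.residueField_map_bijective`); in particular it is
algebraically closed when `B/𝔪_B` is. [cite: Matsumura1987, Thm. 8.11] -/
theorem isAlgClosed_residueField_adicCompletion [IsAlgClosed (ResidueField B)] :
    IsAlgClosed (ResidueField (AdicCompletion (maximalIdeal B) B)) :=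
  IsAlgClosed.of_ringEquiv (k := ResidueField B) _
    (RingEquiv.ofBijective _ (AdicCompletion.residueField_map_bijective B))

/-- The structure map `B → B̂` is injective (`B` is `𝔪`-adically separated, Krull).
[cite: Matsumura1987, Thm. 8.10] -/
theorem algebraMap_adicCompletion_injective :
    Function.Injective (algebraMap B (AdicCompletion (maximalIdeal B) B)) := by
  intro x y hxy
  rw [AdicCompletion.algebraMap_apply, AdicCompletion.algebraMap_apply, Algebra.algebraMap_self,
    RingHom.id_apply, RingHom.id_apply] at hxy
  exact AdicCompletion.of_injective (maximalIdeal B) B hxy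

end Completion

/-! ## Fraction fields of extensions of ramification index `1` -/

/-- For an extension of discrete valuation rings `R → R'` with `𝔪_R R' = 𝔪_{R'}` (ramification
index `1`; such a map is automatically injective) the fraction field of `R'` is the localisation
of `R'` at the image of `R ∖ {0}`: `Frac R' = R'[1/π] = R' ⊗_R Frac R` for a uniformiser `π` of
`R` — every non-zero element of `R'` is a unit times a power of `π` (Serre, *Local Fields*,
Ch. I §1: the fraction field of a DVR `A` with uniformiser `π` is `A[1/π]`). This is the form in
which a cover `R → R'` is base-changed to the generic fibre.
[cite: SerreLocalFields1979, Ch. I §1] -/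
theorem isLocalization_algebraMapSubmonoid_nonZeroDivisors {R R' : Type*} [CommRing R]
    [IsDomain R] [IsDiscreteValuationRing R] [CommRing R'] [IsDomain R']
    [IsDiscreteValuationRing R'] [Algebra R R']
    (h : (maximalIdeal R).map (algebraMap R R') = maximalIdeal R') (K' : Type*) [CommRing K']
    [Algebra R' K'] [IsFractionRing R' K'] :
    IsLocalization (Algebra.algebraMapSubmonoid R' (nonZeroDivisors R)) K' := by
  obtain ⟨ϖ, hϖ⟩ := IsDiscreteValuationRing.exists_irreducible R
  have hϖ' : Irreducible (algebraMap R R' ϖ) := by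
    rw [IsDiscreteValuationRing.irreducible_iff_uniformizer, ← h, hϖ.maximalIdeal_eq,
      Ideal.map_span, Set.image_singleton]
  -- every non-zero `r ∈ R` maps to a unit times a power of the uniformiser, hence to `≠ 0`
  have himage : ∀ r : R, r ≠ 0 → algebraMap R R' r ≠ 0 := fun r hr => by
    obtain ⟨k, v, rfl⟩ := IsDiscreteValuationRing.eq_unit_mul_pow_irreducible hr hϖ
    rw [map_mul, map_pow]
    exact mul_ne_zero ((v.isUnit.map _).ne_zero) (pow_ne_zero _ hϖ'.ne_zero)
  refine (IsLocalization.iff_of_le_of_exists_dvd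
    (M := Algebra.algebraMapSubmonoid R' (nonZeroDivisors R)) (S := K')
    (nonZeroDivisors R') ?_ ?_).mpr inferInstance
  · rintro x ⟨r, hr, rfl⟩
    exact mem_nonZeroDivisors_of_ne_zero
      (himage r (nonZeroDivisors.ne_zero (Submonoid.mem_carrier.mp hr)))
  · intro n hn
    obtain ⟨k, u, hk⟩ :=
      IsDiscreteValuationRing.eq_unit_mul_pow_irreducible (nonZeroDivisors.ne_zero hn) hϖ'
    refine ⟨algebraMap R R' (ϖ ^ k), ⟨ϖ ^ k, ?_, rfl⟩, ?_⟩
    · exact Submonoid.mem_carrier.mpr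
        (mem_nonZeroDivisors_of_ne_zero (pow_ne_zero _ hϖ.ne_zero))
    · rw [map_pow, hk]
      exact Units.mul_left_dvd.mpr (dvd_refl _)

/-! ## The cover -/

/-- **Every discrete valuation ring has a faithfully flat extension of ramification index `1`
to a COMPLETE discrete valuation ring with ALGEBRAICALLY CLOSED residue field.** For a DVR `R`
there is a DVR `R'`, an `R`-algebra, complete for its maximal ideal (hence henselian), with
`R'/𝔪_{R'}` algebraically closed, `R → R'` injective and faithfully flat, and
`𝔪_R R' = 𝔪_{R'}`: the completion of the extension `B ⊇ R` with residue field `(R/𝔪_R)^alg`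
of Matsumura's Thm. 29.1 (`exists_dvr_unramified_isAlgClosed_residueField`); flatness is
torsion-freeness over the Dedekind domain `R` composed with flatness of `B → B̂`, and
faithfulness is `𝔪_R R' = 𝔪_{R'} ≠ R'`. For `R = 𝒪_K`, `K` a local field, `R' ≅ 𝒪̂_{K^nr}`.
[cite: Matsumura1987, Thm. 29.1, p. 223] [cite: SerreLocalFields1979, Ch. II §5, Ch. IV §4 Prop. 16] -/
theorem exists_complete_dvr_faithfullyFlat_unramified_isAlgClosed (R : Type u) [CommRing R]
    [IsDomain R] [IsDiscreteValuationRing R] :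
    ∃ (R' : Type u) (_ : CommRing R') (_ : IsDomain R') (_ : IsDiscreteValuationRing R')
      (_ : Algebra R R'), IsAdicComplete (maximalIdeal R') R' ∧ HenselianLocalRing R' ∧
      IsAlgClosed (ResidueField R') ∧ Module.FaithfullyFlat R R' ∧
      (algebraMap R R').FaithfullyFlat ∧ Function.Injective (algebraMap R R') ∧
      (maximalIdeal R).map (algebraMap R R') = maximalIdeal R' := by
  obtain ⟨B, _, _, _, _, hinj, hmap, halg⟩ := exists_dvr_unramified_isAlgClosed_residueField R
  haveI := isDomain_adicCompletion B
  haveI := isDiscreteValuationRing_adicCompletion B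
  -- the `R`-algebra `B̂` and the tower `R → B → B̂`
  haveI : IsScalarTower R B (AdicCompletion (maximalIdeal B) B) :=
    IsScalarTower.of_algebraMap_eq fun r => by
      rw [AdicCompletion.algebraMap_apply, AdicCompletion.algebraMap_apply, Algebra.algebraMap_self,
        RingHom.id_apply]
  have htower : algebraMap R (AdicCompletion (maximalIdeal B) B) =
      (algebraMap B (AdicCompletion (maximalIdeal B) B)).comp (algebraMap R B) :=
    IsScalarTower.algebraMap_eq R B _
  -- flatness
  haveI : Module.IsTorsionFree R B := (Module.isTorsionFree_iff_algebraMap_injective).mpr hinj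
  haveI : Module.Flat R B := inferInstance
  haveI : Module.Flat R (AdicCompletion (maximalIdeal B) B) :=
    Module.Flat.trans R B (AdicCompletion (maximalIdeal B) B)
  -- `𝔪_R B̂ = 𝔪_{B̂}`
  have hmap' : (maximalIdeal R).map (algebraMap R (AdicCompletion (maximalIdeal B) B)) =
      maximalIdeal (AdicCompletion (maximalIdeal B) B) := by
    rw [htower, ← Ideal.map_map, hmap, AdicCompletion.maximalIdeal_eq_map]
  -- faithfully flat: `𝔪 • B̂ = 𝔪_{B̂} ≠ ⊤` for the unique maximal ideal `𝔪` of `R`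
  have hff : Module.FaithfullyFlat R (AdicCompletion (maximalIdeal B) B) := by
    refine ⟨fun m hm htop => ?_⟩
    have hm' : m = maximalIdeal R := IsLocalRing.eq_maximalIdeal hm
    rw [hm', Ideal.smul_top_eq_map, hmap', Submodule.restrictScalars_eq_top_iff,
      Ideal.eq_top_iff_one] at htop
    exact (IsLocalRing.maximalIdeal.isMaximal _).ne_top (Ideal.eq_top_iff_one _ |>.mpr htop)
  refine ⟨AdicCompletion (maximalIdeal B) B, inferInstance, inferInstance, inferInstance,
    inferInstance, inferInstance, henselianLocalRing_adicCompletion B,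
    @isAlgClosed_residueField_adicCompletion B _ _ _ halg, hff,
    RingHom.faithfullyFlat_algebraMap_iff.mpr hff, ?_, hmap'⟩
  rw [htower, RingHom.coe_comp]
  exact (algebraMap_adicCompletion_injective B).comp hinj

/-- **Strictly local covers of a DVR** (Artin, *Néron Models*, Notation (4): "strictly local,
meaning henselian, with separably closed residue field"): every DVR `R` admits a faithfully flat
extension of DVRs `R → R'` of ramification index `1` with `R'` henselian and `R'/𝔪_{R'}`
separably closed — the hypothesis block of
`Literature.NumberTheory.EllipticCurves.exists_isNeronModel_strictlyLocal`. (Here even complete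
with algebraically closed residue field.) [cite: Artin1986NeronModels, Notation (4), p. 213]
[cite: Matsumura1987, Thm. 29.1, p. 223] -/
theorem exists_strictlyLocal_dvr_faithfullyFlat_unramified (R : Type u) [CommRing R]
    [IsDomain R] [IsDiscreteValuationRing R] :
    ∃ (R' : Type u) (_ : CommRing R') (_ : IsDomain R') (_ : IsDiscreteValuationRing R')
      (_ : HenselianLocalRing R') (_ : Algebra R R'), IsSepClosed (ResidueField R') ∧
      Module.FaithfullyFlat R R' ∧ Function.Injective (algebraMap R R') ∧
      (maximalIdeal R).map (algebraMap R R') = maximalIdeal R' := by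
  obtain ⟨R', _, _, _, _, -, hh, halg, hff, -, hinj, hmap⟩ :=
    exists_complete_dvr_faithfullyFlat_unramified_isAlgClosed R
  exact ⟨R', inferInstance, inferInstance, inferInstance, hh, inferInstance, inferInstance, hff,
    hinj, hmap⟩

end Literature.RingTheory.DiscreteValuationRing

end
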